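/-
Copyright (c) 2026 the pub-hodgecm-mathlib formalisation cell (harness21).  Prover seat hodgecm-mathlib-A-p03 (g26); road «W′ = R1LL-WILD» (architect A-p16 (g28) RULINGS A-32,
A-33, A-35 (b) «(W′5′-LC)»; LEAD F0P3a-plan (g10) WORD T9-25), FILE 2 of 2 (the torus reading), 2026-09-01.
-/
import Literature.NumberTheory.QuadraticForms.HilbertSymbolLocallyConstant     -- ★-to-be FILE 1 (this seat): `(x, θ)_v` locally constant on `K_v^×`
import Literature.NumberTheory.Rogawski1990.RankOneTorusDepthContinuity        -- ★ torus pack: `continuous_frameEntry_apply`, `isUnit_frameEntry`, `frameEntry_sub_apply_eq_zero_iff_not_isRegularElt`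
import Literature.NumberTheory.Rogawski1990.RankOneUnstableDeltaSymbolTorusCoordinates  -- ★-to-be B-p12 (g30) (W′5′-ALG): `valued_toPlace_trc_sub_four` (`|ι tc − 4| = |a − c|²`), the `tc` token
import HarnessLib

/-!
# (W′5′-LC) «`t ↦ (trc t, θ)_v` IS EVENTUALLY CONSTANT along the compact torus `Z(t₀) ⊂ H_v`» — the `E`-side local constancy of the Δ-side unit `(2a + b·trτ, θ)_v`
# of the Labesse–Langlands germ expansion at a (wildly or tamely) RAMIFIED place (Labesse–Langlands 1979 §2 p. 9; Labesse 2024 Prop. 0.0.11 ∕ Th. 0.0.12; Rogawski 1990 §4.9)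

Topic `NumberTheory/Rogawski1990`; namespace `Literature.NumberTheory.Rogawski1990`.  THEOREMS ONLY (no definition, no instance, no notation, no named fact, no `sorry`).
Cell `pub/hodgecm-mathlib` (D-0151), crux H413 = `stmt-HodgeConjecture-24833`, road «W′ = R1LL-WILD» (architect A-p16 (g28): RULING A-32 «`E t := μ_v(τ₁ t)⁻¹ C⁻¹ (2a+b·trτ, θ)_v · …`,
`hE` = … ∧ «`(2a + b·trτ, θ)_v` eventually constant» (κ locally constant on `F_v^×`, `2a_s ≠ 0`)»; RULING A-35 (b) deal (W′5′-LC) to this seat; (W′5′-ALG) = B-p12 (g30)).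
HONEST LABEL: HC_CM is proved only modulo the printed citations (hLiu418, h413) until rung 0 closes; this file is elementary topology of `L_w ∕ L⁺_v` and asserts nothing printed.

THE READING.  In Labesse–Langlands' coordinates `t_w = a + bτ` one has `2a + b·trτ = t_w + t̄_w = (τ₀ t)_w + (τ₁ t)_w` — the TRACE of the frame of `t ∈ Z(t₀)` (the two frame
eigenvalues are `σ_w`-conjugate on the norm-one torus).  The symbol lives on `L⁺_v`, its argument `tc t` is read through `ι_w = toPlace v w` (`ι_w (tc t) = (τ₀ t)_w + (τ₁ t)_w`,
any choice — (W′5′-ALG) produces one); the radius `|4c|` of ★ FILE 1 is transported through `ι_w` by ★ `valued_toPlace` (`v_w ∘ ι_w = v_v^e`, `e ≠ 0`), so NO continuity of an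
inverse of `ι_w` is ever needed (§1).  §2: at every `s ∈ Z(t₀)` with `(τ₀ s)_w + (τ₁ s)_w ≠ 0` — in particular at every SINGULAR `s` (`τ₀ s = τ₁ s` a unit, `char 0`) —
`t ↦ (tc t, θ)_v` is eventually constant; and at every REGULAR `s` so is `t ↦ (bc t, θ)_v` for the difference coordinate `ι_w (bc t) = ((τ₀ t)_w − (τ₁ t)_w) ∕ η`.
* §1 `valued_sub_lt_four_mul_of_toPlace`, **`hilbertSymbol_eventually_eq_of_toPlace_comp`** (generic `F ⊂ E`, `w ∣ v`: a symbol on `F_v` of an argument read continuously in `E_w`).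
* §2 **`hilbertSymbol_traceCoord_eventually_eq`** (`(τ₀ s + τ₁ s)_w ≠ 0`), `frameEntry_add_apply_ne_zero_of_not_isRegularElt`,
  **`hilbertSymbol_traceCoord_eventually_eq_of_not_isRegularElt`** (eventual constancy at singular `s`), `hilbertSymbol_diffCoord_eventually_eq_of_isRegularElt`.
* §3 THE RE-KEYED HEAD (RULING A-38 (b), B-p12 (g30)'s canonical `tc` with `ι_w tc = a∕c + c∕a + 2`, `|ι tc − 4| = |a − c|²`): `hilbertSymbol_eq_one_of_valued_sub_four_lt`
  (generic: `|x − 4| < |16| ⇒ (x, θ)_v = 1`), `…_of_valued_toPlace_sub_four_lt`, **`hilbertSymbol_trc_eq_one_of_valued_sub_lt_four`** (`|a_w − c_w| < |4|_w ⇒ (tc, θ)_v = 1`)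
  + `cast_` + `_of_valued_sub_le` (R-4's `hdeep` shape with `2 ↦ 4`), **`hilbertSymbol_trc_eq_one_of_frame`** (on `Z(t₀)`),
  **`eventually_forall_hilbertSymbol_trc_eq_one_of_not_isRegularElt`** (the `hE` half at a singular `s`: eventually EVERY trace coordinate has symbol `1`).

## References
* [LabesseLanglands1979] J.-P. Labesse, R. P. Langlands, *L-indistinguishability for SL(2)*, Canad. J. Math. 31 (1979), §2 pp. 8–10 ((2.1)–(2.2); `κ` locally constant).
* [Labesse2024StabilisationGermesSL2] J.-P. Labesse, arXiv:2411.14820 v2, Prop. 0.0.11, Th. 0.0.12 (the ramified torus, any residue characteristic).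
* [Rogawski1990] J. D. Rogawski, *Automorphic Representations of Unitary Groups in Three Variables* (1990), §4.9 Lemma 4.9.3 p. 56; §3.6 pp. 31–32.
* [Omeara1963] O. T. O'Meara, *Introduction to Quadratic Forms* (1963), §63A Cor. 63:1b, §63B.
-/

set_option autoImplicit false

noncomputable section

open Set Filter Topology NumberField IsDedekindDomain
open scoped Matrix MatrixGroups

namespace Literature.NumberTheory.Rogawski1990

open Literature.NumberTheory.Automorphic Literature.NumberTheory.Automorphic.UnitaryGroup Literature.NumberTheory.GaloisRepresentations
  Literature.NumberTheory.QuadraticForms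

/-! ## §1 A symbol on `F_v` of an argument read continuously in `E_w` -/

section Transport

variable (F E : Type) [Field F] [NumberField F] [Field E] [NumberField E] [Algebra F E] (v : HeightOneSpectrum (𝓞 F)) (w : PlacesOver E v)

/-- **The `|4c|`-ball is transported through `ι_w`**: `v_w(ι x − ι c) < v_w(ι(4c)) ⇒ v_v(x − c) < v_v(4c)` (★ `valued_toPlace`: `v_w ∘ ι_w = v_v^{e(w|v)}`, `e ≠ 0`,
strict monotonicity of `(·)^e` on the value group). [cite: Omeara1963, §63A] -/
theorem valued_sub_lt_four_mul_of_toPlace {x c : v.adicCompletion F}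
    (h : Valued.v (toPlace v w x - toPlace v w c) < Valued.v (toPlace v w (4 * c))) :
    Valued.v (x - c) < Valued.v (4 * c) := by
  rw [← map_sub, valued_toPlace, valued_toPlace] at h
  haveI := PlacesOver.liesOver w
  exact (pow_lt_pow_iff_left₀ zero_le zero_le (Ideal.IsDedekindDomain.ramificationIdx'_ne_zero_of_liesOver w.1.asIdeal v.ne_bot)).1 h

/-- **A HILBERT SYMBOL ON `F_v` OF AN ARGUMENT READ CONTINUOUSLY IN `E_w` IS EVENTUALLY CONSTANT**: if `ι_w (f x) = g x` for all `x`, `g` is continuous at `s` and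
`g s ≠ 0`, then `∀ᶠ x in 𝓝 s, (f x, θ)_v = (f s, θ)_v` — ★ FILE 1 `hilbertSymbol_eq_of_valued_sub_lt` on the ball pulled back along `g` and pushed down by
`valued_sub_lt_four_mul_of_toPlace`; the continuity of `f` itself is never used. [cite: LabesseLanglands1979, §2 p. 9] [cite: Omeara1963, §63A Cor. 63:1b; §63B] -/
theorem hilbertSymbol_eventually_eq_of_toPlace_comp {X : Type*} [TopologicalSpace X] {f : X → v.adicCompletion F} {g : X → w.1.adicCompletion E} {s : X}
    (hg : ContinuousAt g s) (hfg : ∀ x, toPlace v w (f x) = g x) (hs : g s ≠ 0) (θ : v.adicCompletion F) :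
    ∀ᶠ x in 𝓝 s, hilbertSymbol (v.adicCompletion F) (f x) θ = hilbertSymbol (v.adicCompletion F) (f s) θ := by
  have hfs : f s ≠ 0 := fun h0 => hs (by rw [← hfg s, h0, map_zero])
  filter_upwards [hg.eventually (setOf_valued_sub_lt_four_mul_mem_nhds E w.1 hs)] with x hx
  refine hilbertSymbol_eq_of_valued_sub_lt F v hfs (valued_sub_lt_four_mul_of_toPlace F E v w ?_) θ
  rw [map_mul, map_ofNat, hfg x, hfg s]
  exact hx

/-- Right-slot twin of `hilbertSymbol_eventually_eq_of_toPlace_comp`. [cite: Omeara1963, §63B] -/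
theorem hilbertSymbol_eventually_eq_of_toPlace_comp_right {X : Type*} [TopologicalSpace X] {f : X → v.adicCompletion F} {g : X → w.1.adicCompletion E} {s : X}
    (hg : ContinuousAt g s) (hfg : ∀ x, toPlace v w (f x) = g x) (hs : g s ≠ 0) (a : v.adicCompletion F) :
    ∀ᶠ x in 𝓝 s, hilbertSymbol (v.adicCompletion F) a (f x) = hilbertSymbol (v.adicCompletion F) a (f s) := by
  filter_upwards [hilbertSymbol_eventually_eq_of_toPlace_comp F E v w hg hfg hs a] with x hx
  rw [hilbertSymbol_comm a (f x), hx, hilbertSymbol_comm]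

end Transport

/-! ## §2 Along the compact torus `Z(t₀) ⊂ H_v` -/

section Torus

variable (L : Type) [Field L] [NumberField L] [IsCMField L] (v : HeightOneSpectrum (𝓞 ↥(maximalRealSubfield L)))
  (w : PlacesOver L v) (t₀ : ((cmDatum L 2 (Matrix.of fun i j : Fin 2 => if i.val + j.val + 1 = 2 then (1 : L) else 0)).Local v × (cmDatum L 1 (Matrix.of fun i j : Fin 1 => if i.val + j.val + 1 = 1 then (1 : L) else 0)).Local v))
  (P : GL (Fin 2) (LocalRing L v))

/-- **`t ↦ (tc t, θ)_v` IS EVENTUALLY CONSTANT wherever the frame trace does not vanish**: for ANY `tc : Z(t₀) → L⁺_v` with `ι_w (tc t) = (τ₀ t)_w + (τ₁ t)_w`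
(the trace coordinate `2a + b·trτ` of Labesse–Langlands read in `L⁺_v`) and every `s` with `(τ₀ s)_w + (τ₁ s)_w ≠ 0`: `∀ᶠ t in 𝓝 s, (tc t, θ)_v = (tc s, θ)_v`.  No frame
hypothesis is needed (continuity of the frame entries ★ `continuous_frameEntry_apply` only). [cite: LabesseLanglands1979, §2 p. 9] [cite: Labesse2024StabilisationGermesSL2, Th. 0.0.12] -/
theorem hilbertSymbol_traceCoord_eventually_eq (θ : v.adicCompletion ↥(maximalRealSubfield L))
    (tc : ↥(Subgroup.centralizer ({t₀} : Set ((cmDatum L 2 (Matrix.of fun i j : Fin 2 => if i.val + j.val + 1 = 2 then (1 : L) else 0)).Local v × (cmDatum L 1 (Matrix.of fun i j : Fin 1 => if i.val + j.val + 1 = 1 then (1 : L) else 0)).Local v))) → v.adicCompletion ↥(maximalRealSubfield L))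
    (htc : ∀ t, toPlace v w (tc t) =
      (((P⁻¹).val * ((t : ((cmDatum L 2 (Matrix.of fun i j : Fin 2 => if i.val + j.val + 1 = 2 then (1 : L) else 0)).Local v × (cmDatum L 1 (Matrix.of fun i j : Fin 1 => if i.val + j.val + 1 = 1 then (1 : L) else 0)).Local v)).1.val.val : Matrix (Fin 2) (Fin 2) (LocalRing L v)) * P.val) 0 0) w +
      (((P⁻¹).val * ((t : ((cmDatum L 2 (Matrix.of fun i j : Fin 2 => if i.val + j.val + 1 = 2 then (1 : L) else 0)).Local v × (cmDatum L 1 (Matrix.of fun i j : Fin 1 => if i.val + j.val + 1 = 1 then (1 : L) else 0)).Local v)).1.val.val : Matrix (Fin 2) (Fin 2) (LocalRing L v)) * P.val) 1 1) w)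
    (s : ↥(Subgroup.centralizer ({t₀} : Set ((cmDatum L 2 (Matrix.of fun i j : Fin 2 => if i.val + j.val + 1 = 2 then (1 : L) else 0)).Local v × (cmDatum L 1 (Matrix.of fun i j : Fin 1 => if i.val + j.val + 1 = 1 then (1 : L) else 0)).Local v))))
    (hs : (((P⁻¹).val * ((s : ((cmDatum L 2 (Matrix.of fun i j : Fin 2 => if i.val + j.val + 1 = 2 then (1 : L) else 0)).Local v × (cmDatum L 1 (Matrix.of fun i j : Fin 1 => if i.val + j.val + 1 = 1 then (1 : L) else 0)).Local v)).1.val.val : Matrix (Fin 2) (Fin 2) (LocalRing L v)) * P.val) 0 0) w +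
      (((P⁻¹).val * ((s : ((cmDatum L 2 (Matrix.of fun i j : Fin 2 => if i.val + j.val + 1 = 2 then (1 : L) else 0)).Local v × (cmDatum L 1 (Matrix.of fun i j : Fin 1 => if i.val + j.val + 1 = 1 then (1 : L) else 0)).Local v)).1.val.val : Matrix (Fin 2) (Fin 2) (LocalRing L v)) * P.val) 1 1) w ≠ 0) :
    ∀ᶠ (t : ↥(Subgroup.centralizer ({t₀} : Set ((cmDatum L 2 (Matrix.of fun i j : Fin 2 => if i.val + j.val + 1 = 2 then (1 : L) else 0)).Local v × (cmDatum L 1 (Matrix.of fun i j : Fin 1 => if i.val + j.val + 1 = 1 then (1 : L) else 0)).Local v)))) in 𝓝 s,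
      hilbertSymbol (v.adicCompletion ↥(maximalRealSubfield L)) (tc t) θ = hilbertSymbol (v.adicCompletion ↥(maximalRealSubfield L)) (tc s) θ :=
  hilbertSymbol_eventually_eq_of_toPlace_comp ↥(maximalRealSubfield L) L v w
    ((((continuous_frameEntry_apply L v P 0 0 w).add (continuous_frameEntry_apply L v P 1 1 w)).comp continuous_subtype_val).continuousAt) htc hs θ

variable (hw : IsCMField.complexConj L • w.1 = w.1) (d : Fin 2 → LocalRing L v) (ht₀ : IsRegularElt (t₀.1.val : GL (Fin 2) (LocalRing L v)))
  (hP : (t₀.1.val.val : Matrix (Fin 2) (Fin 2) (LocalRing L v)) * P.val = P.val * Matrix.diagonal d) (hd1 : ∀ i, conjLocal L (IsCMField.complexConj L) v (d i) * d i = 1)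

include hw ht₀ hP hd1

/-- **At a SINGULAR `s ∈ Z(t₀)` the frame trace is `2·(τ₀ s)_w ≠ 0`** (`τ₀ s = τ₁ s` by ★ `frameEntry_sub_apply_eq_zero_iff_not_isRegularElt`, `τ₀ s` a unit by ★ `isUnit_frameEntry`,
`char L_w = 0`). [cite: Rogawski1990, §3.6 pp. 31–32; §4.9 p. 56] -/
theorem frameEntry_add_apply_ne_zero_of_not_isRegularElt
    (s : ↥(Subgroup.centralizer ({t₀} : Set ((cmDatum L 2 (Matrix.of fun i j : Fin 2 => if i.val + j.val + 1 = 2 then (1 : L) else 0)).Local v × (cmDatum L 1 (Matrix.of fun i j : Fin 1 => if i.val + j.val + 1 = 1 then (1 : L) else 0)).Local v))))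
    (hs : ¬ IsRegularElt ((s : ((cmDatum L 2 (Matrix.of fun i j : Fin 2 => if i.val + j.val + 1 = 2 then (1 : L) else 0)).Local v × (cmDatum L 1 (Matrix.of fun i j : Fin 1 => if i.val + j.val + 1 = 1 then (1 : L) else 0)).Local v)).1.val : GL (Fin 2) (LocalRing L v))) :
    (((P⁻¹).val * ((s : ((cmDatum L 2 (Matrix.of fun i j : Fin 2 => if i.val + j.val + 1 = 2 then (1 : L) else 0)).Local v × (cmDatum L 1 (Matrix.of fun i j : Fin 1 => if i.val + j.val + 1 = 1 then (1 : L) else 0)).Local v)).1.val.val : Matrix (Fin 2) (Fin 2) (LocalRing L v)) * P.val) 0 0) w +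
      (((P⁻¹).val * ((s : ((cmDatum L 2 (Matrix.of fun i j : Fin 2 => if i.val + j.val + 1 = 2 then (1 : L) else 0)).Local v × (cmDatum L 1 (Matrix.of fun i j : Fin 1 => if i.val + j.val + 1 = 1 then (1 : L) else 0)).Local v)).1.val.val : Matrix (Fin 2) (Fin 2) (LocalRing L v)) * P.val) 1 1) w ≠ 0 := by
  have hinj : Function.Injective (algebraMap L (w.1.adicCompletion L)) := (algebraMap L (w.1.adicCompletion L)).injective
  haveI : CharZero (w.1.adicCompletion L) := charZero_of_injective_algebraMap hinj
  have h01 := (frameEntry_sub_apply_eq_zero_iff_not_isRegularElt L v w hw t₀ P d ht₀ hP hd1 s).2 hs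
  rw [Pi.sub_apply, sub_eq_zero] at h01
  have hunit : IsUnit ((((P⁻¹).val * ((s : ((cmDatum L 2 (Matrix.of fun i j : Fin 2 => if i.val + j.val + 1 = 2 then (1 : L) else 0)).Local v × (cmDatum L 1 (Matrix.of fun i j : Fin 1 => if i.val + j.val + 1 = 1 then (1 : L) else 0)).Local v)).1.val.val : Matrix (Fin 2) (Fin 2) (LocalRing L v)) * P.val) 0 0) w) :=
    (isUnit_frameEntry L v w hw t₀ P d ht₀ hP hd1 s 0).map (Pi.evalRingHom (fun w' : PlacesOver L v => w'.1.adicCompletion L) w)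
  rw [← h01, ← two_mul]
  exact mul_ne_zero two_ne_zero hunit.ne_zero

/-- **THE `hE` HALF AT A SINGULAR POINT (RULING A-32): `t ↦ (tc t, θ)_v` is eventually constant at every SINGULAR `s ∈ Z(t₀)`** for any trace coordinate `tc`
(`ι_w (tc t) = (τ₀ t)_w + (τ₁ t)_w`). [cite: LabesseLanglands1979, §2 p. 9] [cite: Labesse2024StabilisationGermesSL2, Th. 0.0.12] [cite: Rogawski1990, §4.9 Lemma 4.9.3 p. 56] -/
theorem hilbertSymbol_traceCoord_eventually_eq_of_not_isRegularElt (θ : v.adicCompletion ↥(maximalRealSubfield L))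
    (tc : ↥(Subgroup.centralizer ({t₀} : Set ((cmDatum L 2 (Matrix.of fun i j : Fin 2 => if i.val + j.val + 1 = 2 then (1 : L) else 0)).Local v × (cmDatum L 1 (Matrix.of fun i j : Fin 1 => if i.val + j.val + 1 = 1 then (1 : L) else 0)).Local v))) → v.adicCompletion ↥(maximalRealSubfield L))
    (htc : ∀ t, toPlace v w (tc t) =
      (((P⁻¹).val * ((t : ((cmDatum L 2 (Matrix.of fun i j : Fin 2 => if i.val + j.val + 1 = 2 then (1 : L) else 0)).Local v × (cmDatum L 1 (Matrix.of fun i j : Fin 1 => if i.val + j.val + 1 = 1 then (1 : L) else 0)).Local v)).1.val.val : Matrix (Fin 2) (Fin 2) (LocalRing L v)) * P.val) 0 0) w +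
      (((P⁻¹).val * ((t : ((cmDatum L 2 (Matrix.of fun i j : Fin 2 => if i.val + j.val + 1 = 2 then (1 : L) else 0)).Local v × (cmDatum L 1 (Matrix.of fun i j : Fin 1 => if i.val + j.val + 1 = 1 then (1 : L) else 0)).Local v)).1.val.val : Matrix (Fin 2) (Fin 2) (LocalRing L v)) * P.val) 1 1) w)
    (s : ↥(Subgroup.centralizer ({t₀} : Set ((cmDatum L 2 (Matrix.of fun i j : Fin 2 => if i.val + j.val + 1 = 2 then (1 : L) else 0)).Local v × (cmDatum L 1 (Matrix.of fun i j : Fin 1 => if i.val + j.val + 1 = 1 then (1 : L) else 0)).Local v))))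
    (hs : ¬ IsRegularElt ((s : ((cmDatum L 2 (Matrix.of fun i j : Fin 2 => if i.val + j.val + 1 = 2 then (1 : L) else 0)).Local v × (cmDatum L 1 (Matrix.of fun i j : Fin 1 => if i.val + j.val + 1 = 1 then (1 : L) else 0)).Local v)).1.val : GL (Fin 2) (LocalRing L v))) :
    ∀ᶠ (t : ↥(Subgroup.centralizer ({t₀} : Set ((cmDatum L 2 (Matrix.of fun i j : Fin 2 => if i.val + j.val + 1 = 2 then (1 : L) else 0)).Local v × (cmDatum L 1 (Matrix.of fun i j : Fin 1 => if i.val + j.val + 1 = 1 then (1 : L) else 0)).Local v)))) in 𝓝 s,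
      hilbertSymbol (v.adicCompletion ↥(maximalRealSubfield L)) (tc t) θ = hilbertSymbol (v.adicCompletion ↥(maximalRealSubfield L)) (tc s) θ :=
  hilbertSymbol_traceCoord_eventually_eq L v w t₀ P θ tc htc s (frameEntry_add_apply_ne_zero_of_not_isRegularElt L v w t₀ P hw d ht₀ hP hd1 s hs)

/-- **At a REGULAR `s`, `t ↦ (bc t, θ)_v` is eventually constant** for any difference coordinate `bc` (`ι_w (bc t) = ((τ₀ t)_w − (τ₁ t)_w) ∕ η`, `η ≠ 0` a fixed scalar, e.g. the
skew `τ − τ̄`): `(τ₀ s − τ₁ s)_w ≠ 0` by ★ `frameEntry_sub_apply_eq_zero_iff_not_isRegularElt`. [cite: LabesseLanglands1979, §2 p. 9] [cite: Rogawski1990, §4.9 p. 56] -/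
theorem hilbertSymbol_diffCoord_eventually_eq_of_isRegularElt (θ : v.adicCompletion ↥(maximalRealSubfield L)) {η : w.1.adicCompletion L} (hη : η ≠ 0)
    (bc : ↥(Subgroup.centralizer ({t₀} : Set ((cmDatum L 2 (Matrix.of fun i j : Fin 2 => if i.val + j.val + 1 = 2 then (1 : L) else 0)).Local v × (cmDatum L 1 (Matrix.of fun i j : Fin 1 => if i.val + j.val + 1 = 1 then (1 : L) else 0)).Local v))) → v.adicCompletion ↥(maximalRealSubfield L))
    (hbc : ∀ t, toPlace v w (bc t) =
      ((((P⁻¹).val * ((t : ((cmDatum L 2 (Matrix.of fun i j : Fin 2 => if i.val + j.val + 1 = 2 then (1 : L) else 0)).Local v × (cmDatum L 1 (Matrix.of fun i j : Fin 1 => if i.val + j.val + 1 = 1 then (1 : L) else 0)).Local v)).1.val.val : Matrix (Fin 2) (Fin 2) (LocalRing L v)) * P.val) 0 0) w -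
      (((P⁻¹).val * ((t : ((cmDatum L 2 (Matrix.of fun i j : Fin 2 => if i.val + j.val + 1 = 2 then (1 : L) else 0)).Local v × (cmDatum L 1 (Matrix.of fun i j : Fin 1 => if i.val + j.val + 1 = 1 then (1 : L) else 0)).Local v)).1.val.val : Matrix (Fin 2) (Fin 2) (LocalRing L v)) * P.val) 1 1) w) / η)
    (s : ↥(Subgroup.centralizer ({t₀} : Set ((cmDatum L 2 (Matrix.of fun i j : Fin 2 => if i.val + j.val + 1 = 2 then (1 : L) else 0)).Local v × (cmDatum L 1 (Matrix.of fun i j : Fin 1 => if i.val + j.val + 1 = 1 then (1 : L) else 0)).Local v))))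
    (hs : IsRegularElt ((s : ((cmDatum L 2 (Matrix.of fun i j : Fin 2 => if i.val + j.val + 1 = 2 then (1 : L) else 0)).Local v × (cmDatum L 1 (Matrix.of fun i j : Fin 1 => if i.val + j.val + 1 = 1 then (1 : L) else 0)).Local v)).1.val : GL (Fin 2) (LocalRing L v))) :
    ∀ᶠ (t : ↥(Subgroup.centralizer ({t₀} : Set ((cmDatum L 2 (Matrix.of fun i j : Fin 2 => if i.val + j.val + 1 = 2 then (1 : L) else 0)).Local v × (cmDatum L 1 (Matrix.of fun i j : Fin 1 => if i.val + j.val + 1 = 1 then (1 : L) else 0)).Local v)))) in 𝓝 s,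
      hilbertSymbol (v.adicCompletion ↥(maximalRealSubfield L)) (bc t) θ = hilbertSymbol (v.adicCompletion ↥(maximalRealSubfield L)) (bc s) θ := by
  have hne : (((P⁻¹).val * ((s : ((cmDatum L 2 (Matrix.of fun i j : Fin 2 => if i.val + j.val + 1 = 2 then (1 : L) else 0)).Local v × (cmDatum L 1 (Matrix.of fun i j : Fin 1 => if i.val + j.val + 1 = 1 then (1 : L) else 0)).Local v)).1.val.val : Matrix (Fin 2) (Fin 2) (LocalRing L v)) * P.val) 0 0) w -
      (((P⁻¹).val * ((s : ((cmDatum L 2 (Matrix.of fun i j : Fin 2 => if i.val + j.val + 1 = 2 then (1 : L) else 0)).Local v × (cmDatum L 1 (Matrix.of fun i j : Fin 1 => if i.val + j.val + 1 = 1 then (1 : L) else 0)).Local v)).1.val.val : Matrix (Fin 2) (Fin 2) (LocalRing L v)) * P.val) 1 1) w ≠ 0 := by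
    intro h0
    have h := (frameEntry_sub_apply_eq_zero_iff_not_isRegularElt L v w hw t₀ P d ht₀ hP hd1 s).1 (by rw [Pi.sub_apply]; exact h0)
    exact h hs
  exact hilbertSymbol_eventually_eq_of_toPlace_comp ↥(maximalRealSubfield L) L v w
    (((((continuous_frameEntry_apply L v P 0 0 w).sub (continuous_frameEntry_apply L v P 1 1 w)).div_const η).comp continuous_subtype_val).continuousAt)
    hbc (div_ne_zero hne hη) θ

end Torus

/-! ## §3 RE-KEYED HEAD (RULING A-38 (b)): on the DEEP torus the trace symbol is TRIVIAL, `(tc t, θ)_v = 1` -/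

section Deep

variable (K : Type*) [Field K] [NumberField K] (v : HeightOneSpectrum (𝓞 K))

/-- **`v(x − 4) < v(16)` ⇒ `(x, θ)_v = 1`**: `x` is `|4·4|`-close to `4 = 2²`, so `(x, θ)_v = (4, θ)_v` (★ FILE 1) `= (1·2², θ)_v = (1, θ)_v = 1` — any finite place, dyadic included.
[cite: Omeara1963, §63A Cor. 63:1b; §63B] -/
theorem hilbertSymbol_eq_one_of_valued_sub_four_lt {x : v.adicCompletion K} (h : Valued.v (x - 4) < Valued.v ((4 : v.adicCompletion K) * 4)) (θ : v.adicCompletion K) :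
    hilbertSymbol (v.adicCompletion K) x θ = 1 := by
  haveI : CharZero (v.adicCompletion K) := charZero_of_injective_algebraMap (algebraMap K _).injective
  have h4 : (4 : v.adicCompletion K) ≠ 0 := by norm_num
  rw [hilbertSymbol_eq_of_valued_sub_lt K v h4 h θ, show (4 : v.adicCompletion K) = 1 * 2 ^ 2 by norm_num,
    hilbertSymbol_mul_sq_left 1 θ two_ne_zero, hilbertSymbol_one_left]

end Deep

section DeepTransport

variable (F E : Type) [Field F] [NumberField F] [Field E] [NumberField E] [Algebra F E] (v : HeightOneSpectrum (𝓞 F)) (w : PlacesOver E v)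

/-- **`v_w(ι_w x − 4) < v_w(16)` ⇒ `(x, θ)_v = 1`** — the same through the place embedding `ι_w` (§1 transport at `c := 4`). [cite: Omeara1963, §63A Cor. 63:1b; §63B] -/
theorem hilbertSymbol_eq_one_of_valued_toPlace_sub_four_lt {x : v.adicCompletion F}
    (h : Valued.v (toPlace v w x - 4) < Valued.v ((4 : w.1.adicCompletion E) * 4)) (θ : v.adicCompletion F) :
    hilbertSymbol (v.adicCompletion F) x θ = 1 := by
  refine hilbertSymbol_eq_one_of_valued_sub_four_lt F v (valued_sub_lt_four_mul_of_toPlace F E v w ?_) θ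
  rw [map_mul, map_ofNat]
  exact h

end DeepTransport

section DeepCM

variable (L : Type) [Field L] [NumberField L] [IsCMField L] (v : HeightOneSpectrum (𝓞 ↥(maximalRealSubfield L)))
  (w : PlacesOver L v) (hw : IsCMField.complexConj L • w.1 = w.1)

include hw in
/-- **THE RE-KEYED (W′5′-LC) HEAD (architect A-p16 (g28) RULING A-38 (b)), in ★ R-4 ∕ (W′5′-ALG) tokens: for norm-one `a, c ∈ E_v` with `|a_w − c_w|_w < |4|_w` and ANY trace
coordinate `tc ∈ L⁺_vˣ` (`ι_w tc = a_w∕c_w + c_w∕a_w + 2`, B-p12 (g30)), `(tc, θ)_v = 1`** — `|ι tc − 4| = |a − c|² < |16|` (★ `valued_toPlace_trc_sub_four`) and §3 generic.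
At a TAME place `|4|_w = 1` and the hypothesis is just `a_w ≢ c_w`-depth `≥ 1`; at a WILD place it is depth `> 2·ord_w 2`. [cite: LabesseLanglands1979, §2 (2.2) p. 9]
[cite: Labesse2024StabilisationGermesSL2, Th. 0.0.12] [cite: Rogawski1990, §4.9 Lemma 4.9.3 p. 56] -/
theorem hilbertSymbol_trc_eq_one_of_valued_sub_lt_four {a c : LocalRing L v} (ha : conjLocal L (IsCMField.complexConj L) v a * a = 1)
    (hc : conjLocal L (IsCMField.complexConj L) v c * c = 1) {tc : (v.adicCompletion ↥(maximalRealSubfield L))ˣ}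
    (htc : toPlace v w (tc : v.adicCompletion ↥(maximalRealSubfield L)) = a w / c w + c w / a w + 2)
    (hdeep : Valued.v (a w - c w) < Valued.v (4 : w.1.adicCompletion L)) (θ : v.adicCompletion ↥(maximalRealSubfield L)) :
    hilbertSymbol (v.adicCompletion ↥(maximalRealSubfield L)) (tc : v.adicCompletion ↥(maximalRealSubfield L)) θ = 1 := by
  refine hilbertSymbol_eq_one_of_valued_toPlace_sub_four_lt ↥(maximalRealSubfield L) L v w ?_ θ
  rw [valued_toPlace_trc_sub_four L v w hw ha hc htc, Valuation.map_mul, ← sq]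
  exact (pow_lt_pow_iff_left₀ zero_le zero_le two_ne_zero).2 hdeep

include hw in
/-- `ℂ`-cast form of `hilbertSymbol_trc_eq_one_of_valued_sub_lt_four` (the `E t` factor of RULING A-32 is `1` on the deep torus). [cite: LabesseLanglands1979, §2 (2.2) p. 9] -/
theorem cast_hilbertSymbol_trc_eq_one_of_valued_sub_lt_four {a c : LocalRing L v} (ha : conjLocal L (IsCMField.complexConj L) v a * a = 1)
    (hc : conjLocal L (IsCMField.complexConj L) v c * c = 1) {tc : (v.adicCompletion ↥(maximalRealSubfield L))ˣ}
    (htc : toPlace v w (tc : v.adicCompletion ↥(maximalRealSubfield L)) = a w / c w + c w / a w + 2)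
    (hdeep : Valued.v (a w - c w) < Valued.v (4 : w.1.adicCompletion L)) (θ : v.adicCompletion ↥(maximalRealSubfield L)) :
    ((hilbertSymbol (v.adicCompletion ↥(maximalRealSubfield L)) (tc : v.adicCompletion ↥(maximalRealSubfield L)) θ : ℤ) : ℂ) = 1 := by
  rw [hilbertSymbol_trc_eq_one_of_valued_sub_lt_four L v w hw ha hc htc hdeep θ, Int.cast_one]

include hw in
/-- **★ R-4's `hdeep` SHAPE with `2 ↦ 4`**: `|a_w − c_w| ≤ |4π|` for some `|π| < 1` (e.g. `π = ι_w ϖ_v ^ M₀`, `M₀ ≥ 1`) ⇒ `(tc, θ)_v = 1`. [cite: Rogawski1990, §4.9 Lemma 4.9.3 p. 56] -/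
theorem hilbertSymbol_trc_eq_one_of_valued_sub_le {a c : LocalRing L v} (ha : conjLocal L (IsCMField.complexConj L) v a * a = 1)
    (hc : conjLocal L (IsCMField.complexConj L) v c * c = 1) {tc : (v.adicCompletion ↥(maximalRealSubfield L))ˣ}
    (htc : toPlace v w (tc : v.adicCompletion ↥(maximalRealSubfield L)) = a w / c w + c w / a w + 2)
    {π : w.1.adicCompletion L} (hπ : Valued.v π < 1) (hdeep : Valued.v (a w - c w) ≤ Valued.v (4 * π)) (θ : v.adicCompletion ↥(maximalRealSubfield L)) :
    hilbertSymbol (v.adicCompletion ↥(maximalRealSubfield L)) (tc : v.adicCompletion ↥(maximalRealSubfield L)) θ = 1 := by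
  haveI : CharZero (w.1.adicCompletion L) := charZero_of_injective_algebraMap (algebraMap L (w.1.adicCompletion L)).injective
  have h4 : (4 : w.1.adicCompletion L) ≠ 0 := by norm_num
  refine hilbertSymbol_trc_eq_one_of_valued_sub_lt_four L v w hw ha hc htc (lt_of_le_of_lt hdeep ?_) θ
  rw [Valuation.map_mul]
  exact mul_lt_of_lt_one_right ((Valuation.pos_iff _).2 h4) hπ

end DeepCM

section DeepTorus

variable (L : Type) [Field L] [NumberField L] [IsCMField L] (v : HeightOneSpectrum (𝓞 ↥(maximalRealSubfield L)))
  (w : PlacesOver L v) (t₀ : ((cmDatum L 2 (Matrix.of fun i j : Fin 2 => if i.val + j.val + 1 = 2 then (1 : L) else 0)).Local v × (cmDatum L 1 (Matrix.of fun i j : Fin 1 => if i.val + j.val + 1 = 1 then (1 : L) else 0)).Local v)) (P : GL (Fin 2) (LocalRing L v))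
  (hw : IsCMField.complexConj L • w.1 = w.1) (d : Fin 2 → LocalRing L v) (ht₀ : IsRegularElt (t₀.1.val : GL (Fin 2) (LocalRing L v)))
  (hP : (t₀.1.val.val : Matrix (Fin 2) (Fin 2) (LocalRing L v)) * P.val = P.val * Matrix.diagonal d) (hd1 : ∀ i, conjLocal L (IsCMField.complexConj L) v (d i) * d i = 1)

include hw ht₀ hP hd1

/-- **ON THE TORUS `Z(t₀)`: `(tc, θ)_v = 1` at every `t` of depth `|(τ₀ t − τ₁ t)_w| < |4|_w`** for any trace coordinate of `t` (`ι_w tc = τ₀∕τ₁ + τ₁∕τ₀ + 2` at `w`;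
the frame eigenvalues are norm-one by ★ `conjLocal_frameEntry_mul_self_apply`). [cite: LabesseLanglands1979, §2 (2.2) p. 9] [cite: Rogawski1990, §4.9 Lemma 4.9.3 p. 56] -/
theorem hilbertSymbol_trc_eq_one_of_frame (t : ↥(Subgroup.centralizer ({t₀} : Set ((cmDatum L 2 (Matrix.of fun i j : Fin 2 => if i.val + j.val + 1 = 2 then (1 : L) else 0)).Local v × (cmDatum L 1 (Matrix.of fun i j : Fin 1 => if i.val + j.val + 1 = 1 then (1 : L) else 0)).Local v))))
    {tc : (v.adicCompletion ↥(maximalRealSubfield L))ˣ}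
    (htc : toPlace v w (tc : v.adicCompletion ↥(maximalRealSubfield L)) =
      (((P⁻¹).val * ((t : ((cmDatum L 2 (Matrix.of fun i j : Fin 2 => if i.val + j.val + 1 = 2 then (1 : L) else 0)).Local v × (cmDatum L 1 (Matrix.of fun i j : Fin 1 => if i.val + j.val + 1 = 1 then (1 : L) else 0)).Local v)).1.val.val : Matrix (Fin 2) (Fin 2) (LocalRing L v)) * P.val) 0 0) w / (((P⁻¹).val * ((t : ((cmDatum L 2 (Matrix.of fun i j : Fin 2 => if i.val + j.val + 1 = 2 then (1 : L) else 0)).Local v × (cmDatum L 1 (Matrix.of fun i j : Fin 1 => if i.val + j.val + 1 = 1 then (1 : L) else 0)).Local v)).1.val.val : Matrix (Fin 2) (Fin 2) (LocalRing L v)) * P.val) 1 1) w + (((P⁻¹).val * ((t : ((cmDatum L 2 (Matrix.of fun i j : Fin 2 => if i.val + j.val + 1 = 2 then (1 : L) else 0)).Local v × (cmDatum L 1 (Matrix.of fun i j : Fin 1 => if i.val + j.val + 1 = 1 then (1 : L) else 0)).Local v)).1.val.val : Matrix (Fin 2) (Fin 2) (LocalRing L v)) * P.val) 1 1) w / (((P⁻¹).val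 * ((t : ((cmDatum L 2 (Matrix.of fun i j : Fin 2 => if i.val + j.val + 1 = 2 then (1 : L) else 0)).Local v × (cmDatum L 1 (Matrix.of fun i j : Fin 1 => if i.val + j.val + 1 = 1 then (1 : L) else 0)).Local v)).1.val.val : Matrix (Fin 2) (Fin 2) (LocalRing L v)) * P.val) 0 0) w + 2)
    (hdeep : Valued.v (((((P⁻¹).val * ((t : ((cmDatum L 2 (Matrix.of fun i j : Fin 2 => if i.val + j.val + 1 = 2 then (1 : L) else 0)).Local v × (cmDatum L 1 (Matrix.of fun i j : Fin 1 => if i.val + j.val + 1 = 1 then (1 : L) else 0)).Local v)).1.val.val : Matrix (Fin 2) (Fin 2) (LocalRing L v)) * P.val) 0 0) - (((P⁻¹).val * ((t : ((cmDatum L 2 (Matrix.of fun i j : Fin 2 => if i.val + j.val + 1 = 2 then (1 : L) else 0)).Local v × (cmDatum L 1 (Matrix.of fun i j : Fin 1 => if i.val + j.val + 1 = 1 then (1 : L) else 0)).Local v)).1.val.val : Matrix (Fin 2) (Fin 2) (LocalRing L v)) * P.val) 1 1)) w) < Valued.v (4 : w.1.adicCompletion L))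
    (θ : v.adicCompletion ↥(maximalRealSubfield L)) :
    hilbertSymbol (v.adicCompletion ↥(maximalRealSubfield L)) (tc : v.adicCompletion ↥(maximalRealSubfield L)) θ = 1 :=
  hilbertSymbol_trc_eq_one_of_valued_sub_lt_four L v w hw (conjLocal_frameEntry_mul_self_apply L v w hw t₀ P d ht₀ hP hd1 t 0)
    (conjLocal_frameEntry_mul_self_apply L v w hw t₀ P d ht₀ hP hd1 t 1) htc (by rw [Pi.sub_apply] at hdeep; exact hdeep) θ

/-- **THE `hE` HALF AT A SINGULAR POINT, RE-KEYED (RULING A-38 (b)): near every SINGULAR `s ∈ Z(t₀)`, EVERY trace coordinate has trivial symbol** —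
`∀ᶠ t in 𝓝 s, ∀ tc, ι_w tc = (τ₀∕τ₁ + τ₁∕τ₀ + 2)(t)_w → (tc, θ)_v = 1` (depth `→ ∞` at `s`: ★ `eventually_valued_frameEntry_sub_lt_of_not_isRegularElt` with `π := 4`).
[cite: LabesseLanglands1979, §2 (2.2) p. 9] [cite: Labesse2024StabilisationGermesSL2, Th. 0.0.12] [cite: Rogawski1990, §4.9 Lemma 4.9.3 (4.9.2) p. 56] -/
theorem eventually_forall_hilbertSymbol_trc_eq_one_of_not_isRegularElt (s : ↥(Subgroup.centralizer ({t₀} : Set ((cmDatum L 2 (Matrix.of fun i j : Fin 2 => if i.val + j.val + 1 = 2 then (1 : L) else 0)).Local v × (cmDatum L 1 (Matrix.of fun i j : Fin 1 => if i.val + j.val + 1 = 1 then (1 : L) else 0)).Local v))))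
    (hs : ¬ IsRegularElt ((s : ((cmDatum L 2 (Matrix.of fun i j : Fin 2 => if i.val + j.val + 1 = 2 then (1 : L) else 0)).Local v × (cmDatum L 1 (Matrix.of fun i j : Fin 1 => if i.val + j.val + 1 = 1 then (1 : L) else 0)).Local v)).1.val : GL (Fin 2) (LocalRing L v))) (θ : v.adicCompletion ↥(maximalRealSubfield L)) :
    ∀ᶠ (t : ↥(Subgroup.centralizer ({t₀} : Set ((cmDatum L 2 (Matrix.of fun i j : Fin 2 => if i.val + j.val + 1 = 2 then (1 : L) else 0)).Local v × (cmDatum L 1 (Matrix.of fun i j : Fin 1 => if i.val + j.val + 1 = 1 then (1 : L) else 0)).Local v)))) in 𝓝 s, ∀ tc : (v.adicCompletion ↥(maximalRealSubfield L))ˣ,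
      toPlace v w (tc : v.adicCompletion ↥(maximalRealSubfield L)) =
        (((P⁻¹).val * ((t : ((cmDatum L 2 (Matrix.of fun i j : Fin 2 => if i.val + j.val + 1 = 2 then (1 : L) else 0)).Local v × (cmDatum L 1 (Matrix.of fun i j : Fin 1 => if i.val + j.val + 1 = 1 then (1 : L) else 0)).Local v)).1.val.val : Matrix (Fin 2) (Fin 2) (LocalRing L v)) * P.val) 0 0) w / (((P⁻¹).val * ((t : ((cmDatum L 2 (Matrix.of fun i j : Fin 2 => if i.val + j.val + 1 = 2 then (1 : L) else 0)).Local v × (cmDatum L 1 (Matrix.of fun i j : Fin 1 => if i.val + j.val + 1 = 1 then (1 : L) else 0)).Local v)).1.val.val : Matrix (Fin 2) (Fin 2) (LocalRing L v)) * P.val) 1 1) w + (((P⁻¹).val * ((t : ((cmDatum L 2 (Matrix.of fun i j : Fin 2 => if i.val + j.val + 1 = 2 then (1 : L) else 0)).Local v × (cmDatum L 1 (Matrix.of fun i j : Fin 1 => if i.val + j.val + 1 = 1 then (1 : L) else 0)).Local v)).1.val.val : Matrix (Fin 2) (Fin 2) (LocalRing L v)) * P.val) 1 1) w / (((P⁻¹).val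 * ((t : ((cmDatum L 2 (Matrix.of fun i j : Fin 2 => if i.val + j.val + 1 = 2 then (1 : L) else 0)).Local v × (cmDatum L 1 (Matrix.of fun i j : Fin 1 => if i.val + j.val + 1 = 1 then (1 : L) else 0)).Local v)).1.val.val : Matrix (Fin 2) (Fin 2) (LocalRing L v)) * P.val) 0 0) w + 2 →
      hilbertSymbol (v.adicCompletion ↥(maximalRealSubfield L)) (tc : v.adicCompletion ↥(maximalRealSubfield L)) θ = 1 := by
  haveI : CharZero (w.1.adicCompletion L) := charZero_of_injective_algebraMap (algebraMap L (w.1.adicCompletion L)).injective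
  have h4 : (4 : w.1.adicCompletion L) ≠ 0 := by norm_num
  filter_upwards [eventually_valued_frameEntry_sub_lt_of_not_isRegularElt L v w hw t₀ P d ht₀ hP hd1 s hs 4 h4] with t ht tc htc
  exact hilbertSymbol_trc_eq_one_of_frame L v w t₀ P hw d ht₀ hP hd1 t htc ht θ

end DeepTorus

end Literature.NumberTheory.Rogawski1990

end
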